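import Summits.Ventures.QEC.CircuitDistance.ETowerFiberW
import Summits.Ventures.QEC.CircuitDistance.ETowerTrans
import HarnessLib

/-!
# P3-PORT STEP 2 (E-fold tower): the fibre predicate, FOLD-LINEARITY WITH EXTENSION (S2), the GUARD (S5), NODE SOUNDNESS,
# and the one-level COMPLETENESS LIFT (CARD-7 §5 S2/S5 + induction step; PORT-SPEC S2/S5; crit-1 N1)
# (cell `qec`, experiment CDX, seat qec-cdx-type-1; twins of `Census.FoldAssembly` / `FoldDriver` / `FoldTrans.goodFib_of_trans`)

* `GoodFibK G nb col W Q v`: every big word (`nK` bits) with zero `col`-syndrome, weight `≤ W` and fold `v` satisfies `Q`.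
* S2 `RowCompat colB colS G nb R` — the rows of the small (extended) table are the combinations `R` of the rows of the big one,
  read column-wise: `colS (foldIdx J) = R · colB J`; decided per level on the emitted tables (`rowCompat_of_check`); gives
  `kerK_foldWK` (the fold maps the big kernel into the small kernel).  This replaces the Census `Geo.ColFold` (geometric rows
  only) and is the ONLY place the V-extension enters: the invariant carried down the tower is «extended syndrome = 0».
* S5 `goodFibK_of_guarded` — pair de-duplication by the fibre generator, with KERNEL INVARIANCE `hK` (from `ETowerTrans`,
  row-space data) in place of the Census entrywise column equivariance.
* `nodeK_sound` / `nodeKW_sound` — a passing (windowed) node of `ETowerDefs` gives `GoodFibK … Q (maskOf S)`.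
* `complete_liftK` — the induction step of the tower.
Generic; no data; no `native_decide`.
-/

namespace Summit.Ventures.QEC.CircuitDistance.ETower

open Summit.Ventures.QEC.Census Summit.Ventures.QEC.Census.Fold

/-! ## The fibre predicate -/

/-- Every big word (`nK G nb` bits) with zero `col`-syndrome of weight `≤ W` whose fold is `v` satisfies `Q`. -/
def GoodFibK (G : Geo) (nb : ℕ) (col : ℕ → ℕ) (W : ℕ) (Q : ℕ → Prop) (v : ℕ) : Prop :=
  ∀ u, u < 2 ^ nK G nb → kerK col (nK G nb) u → popc (nK G nb) u ≤ W → foldWK G nb u = v → Q u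

/-! ## S2: fold-linearity with extension, from row-compatibility data -/

/-- ROW COMPATIBILITY AS DATA: column `foldIdx J` of the small table is `R ·` column `J` of the big table (`R` = row masks). -/
def RowCompat (G : Geo) (nb : ℕ) (colB colS : ℕ → ℕ) (R : List ℕ) : Prop :=
  ∀ J, J < nK G nb → colS (G.foldIdx J) = selXor R (colB J)

/-- The Bool form of `RowCompat`. -/
def rowCompatCheck (G : Geo) (nb : ℕ) (colB colS : ℕ → ℕ) (R : List ℕ) : Bool :=
  (List.range (nK G nb)).all fun J => colS (G.foldIdx J) == selXor R (colB J)

/-- `rowCompatCheck` decides `RowCompat`. -/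
theorem rowCompat_of_check {G : Geo} {nb : ℕ} {colB colS : ℕ → ℕ} {R : List ℕ}
    (h : rowCompatCheck G nb colB colS R = true) : RowCompat G nb colB colS R := by
  intro J hJ
  unfold rowCompatCheck at h
  rw [List.all_eq_true] at h
  have := h J (List.mem_range.2 hJ)
  rwa [beq_iff_eq] at this

section Level

variable {G : Geo} {nb : ℕ}

/-- Syndrome of the fold = `R ·` syndrome (under row compatibility). -/
theorem lin_colS_foldWK (hG : OKK G nb) {colB colS : ℕ → ℕ} {R : List ℕ} (hR : RowCompat G nb colB colS R) (u : ℕ) :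
    lin colS (nsK G nb) 0 (foldWK G nb u) = selXor R (lin colB (nK G nb) 0 u) := by
  rw [foldWK, lin_lin, map_lin_of_xor (selXor R) (selXor_zero R) (selXor_xor R)]
  exact lin_congr (i0 := 0) (fun J hJ => by
    rw [Nat.zero_add, lin_two_pow _ _ 0 _ (hG.foldIdx_lt J hJ), Nat.zero_add, hR J hJ]) u

/-- **S2: the fold maps the big kernel into the small kernel** (extension rows included). -/
theorem kerK_foldWK (hG : OKK G nb) {colB colS : ℕ → ℕ} {R : List ℕ} (hR : RowCompat G nb colB colS R) {u : ℕ}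
    (hker : kerK colB (nK G nb) u) : kerK colS (nsK G nb) (foldWK G nb u) := by
  unfold kerK at hker ⊢
  rw [lin_colS_foldWK hG hR, hker, selXor_zero]

/-- The fold does not increase weight. -/
theorem popc_foldWK_le (hG : OKK G nb) {u : ℕ} (hu : u < 2 ^ nK G nb) :
    popc (nsK G nb) (foldWK G nb u) ≤ popc (nK G nb) u := by
  rw [foldWK_eq_parts, popc_eq_partsK hG hu]
  have := popc_xor_add (nsK G nb) (aPartK G nb u) (bPartK G nb u)
  omega

/-! ## Transport of `GoodFibK` along small translations -/

/-- If `Q` is closed under un-translating and the kernel is translation invariant, `GoodFibK` of a translated small word gives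
`GoodFibK` of the word. -/
theorem goodFibK_of_trans (hS : G.Shape) (hG : OKK G nb) {col : ℕ → ℕ} {da db : ℕ}
    (hK : ∀ u, u < 2 ^ nK G nb → (kerK col (nK G nb) u ↔ kerK col (nK G nb) (transWK G.l G.m nb da db u)))
    {W : ℕ} {Q : ℕ → Prop} (hQ : ∀ u, Q (transWK G.l G.m nb da db u) → Q u) {v : ℕ}
    (h : GoodFibK G nb col W Q (transWK G.ls G.ms nb da db v)) : GoodFibK G nb col W Q v := by
  intro u hu hker hwt hfold
  have hl : 0 < G.l := hS.l_pos
  have hm : 0 < G.m := hS.m_pos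
  apply hQ u
  refine h (transWK G.l G.m nb da db u) ?_ ?_ ?_ ?_
  · exact transWK_lt hl hm nb da db u
  · exact (hK u hu).1 hker
  · unfold nK; rw [popc_transWK hl hm]; exact hwt
  · rw [foldWK_transWK hS hG, hfold]

/-! ## The completeness lift (one level of the induction) -/

/-- **COMPLETENESS LIFT.**  If every small kernel word of weight `≤ W` translates onto a listed representative (`hbase`),
`GoodFibK … Q` holds at every representative (`hreps`), `Q` is closed under un-translating, the big kernel is translation
invariant (`hK`) and folds into the small kernel (`hR`), then `Q` holds for every big kernel word of weight `≤ W`. -/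
theorem complete_liftK (hS : G.Shape) (hG : OKK G nb) {colB colS : ℕ → ℕ} {R : List ℕ} (hR : RowCompat G nb colB colS R)
    (hK : ∀ da db u, u < 2 ^ nK G nb → (kerK colB (nK G nb) u ↔ kerK colB (nK G nb) (transWK G.l G.m nb da db u)))
    {W : ℕ} {Ts : List ℕ} {Q : ℕ → Prop} (hQ : ∀ da db u, Q (transWK G.l G.m nb da db u) → Q u)
    (hbase : ∀ s, s < 2 ^ nsK G nb → kerK colS (nsK G nb) s → popc (nsK G nb) s ≤ W → MatchedK G.ls G.ms nb Ts s)
    (hreps : ∀ t ∈ Ts, GoodFibK G nb colB W Q t) :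
    ∀ u, u < 2 ^ nK G nb → kerK colB (nK G nb) u → popc (nK G nb) u ≤ W → Q u := by
  intro u hu hker hwt
  have hsk : kerK colS (nsK G nb) (foldWK G nb u) := kerK_foldWK hG hR hker
  obtain ⟨t, ht, da, db, htr⟩ := hbase _ (foldWK_lt hG u) hsk ((popc_foldWK_le hG hu).trans hwt)
  have hgood : GoodFibK G nb colB W Q (transWK G.ls G.ms nb da db (foldWK G nb u)) := by rw [htr]; exact hreps t ht
  exact goodFibK_of_trans hS hG (hK da db) (hQ da db) hgood u hu hker hwt rfl

/-! ## S5: pair de-duplication by the fibre generator -/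

/-- Bit of a big word at a section point = bit of its section part. -/
theorem testBit_emb_eqK (hG : OKK G nb) {u : ℕ} (hu : u < 2 ^ nK G nb) {j : ℕ} (hj : j < nsK G nb) :
    u.testBit (G.emb j) = (aPartK G nb u).testBit j := by
  conv_lhs => rw [reconK hG hu]
  rw [Nat.testBit_xor]
  have h2 : (parWK G nb (bPartK G nb u)).testBit (G.emb j) = false := by
    rw [Bool.eq_false_iff]; intro h
    obtain ⟨j', hj', -, he⟩ := (testBit_parWK hG).1 h
    have := hG.fold_partner _ (hG.emb_lt j' hj')
    rw [he, hG.fold_emb j hj, hG.fold_emb j' hj'] at this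
    subst this
    exact hG.partner_emb_ne _ hj' he
  rw [h2, Bool.xor_false]
  rcases hb : (aPartK G nb u).testBit j with _ | _
  · rw [Bool.eq_false_iff]; intro h
    obtain ⟨j', hj', hb', he⟩ := (testBit_embWK hG).1 h
    have := emb_injK hG hj' hj he; subst this
    rw [hb] at hb'; exact Bool.false_ne_true hb'
  · exact (testBit_embWK hG).2 ⟨j, hj, hb, rfl⟩

/-- Bit of a big word at a partner point = bit of its partner part. -/
theorem testBit_partner_emb_eqK (hG : OKK G nb) {u : ℕ} (hu : u < 2 ^ nK G nb) {j : ℕ} (hj : j < nsK G nb) :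
    u.testBit (G.partner (G.emb j)) = (bPartK G nb u).testBit j := by
  conv_lhs => rw [reconK hG hu]
  rw [Nat.testBit_xor]
  have h1 : (embWK G nb (aPartK G nb u)).testBit (G.partner (G.emb j)) = false := by
    rw [Bool.eq_false_iff]; intro h
    obtain ⟨j', hj', -, he⟩ := (testBit_embWK hG).1 h
    have := hG.fold_partner _ (hG.emb_lt j hj)
    rw [← he, hG.fold_emb j hj, hG.fold_emb j' hj'] at this
    subst this
    exact hG.partner_emb_ne _ hj he.symm
  rw [h1, Bool.false_xor]
  rcases hb : (bPartK G nb u).testBit j with _ | _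
  · rw [Bool.eq_false_iff]; intro h
    obtain ⟨j', hj', hb', he⟩ := (testBit_parWK hG).1 h
    have := partner_emb_injK hG hj' hj he; subst this
    rw [hb] at hb'; exact Bool.false_ne_true hb'
  · exact (testBit_parWK hG).2 ⟨j, hj, hb, rfl⟩

/-- **S5 (PAIR DE-DUPLICATION).**  If the fold `t` has bit `p₀` and the check established, for every word of the fibre, «no bit
at `emb p₀`, or `Q`», then `Q` holds on the whole fibre (`Q` closed under un-translating by the generator, kernel invariant). -/
theorem goodFibK_of_guarded (hG : OKK G nb) (hS : G.Shape) {col : ℕ → ℕ}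
    (hK : ∀ u, u < 2 ^ nK G nb → (kerK col (nK G nb) u ↔ kerK col (nK G nb) (transWK G.l G.m nb G.gen.1 G.gen.2 u)))
    {W t p₀ : ℕ} (ht : t < 2 ^ nsK G nb) (hp₀ : p₀ < nsK G nb) (htp : t.testBit p₀ = true) {Q : ℕ → Prop}
    (hQ : ∀ u, Q (transWK G.l G.m nb G.gen.1 G.gen.2 u) → Q u)
    (h : GoodFibK G nb col W (fun u => u.testBit (G.emb p₀) = false ∨ Q u) t) : GoodFibK G nb col W Q t := by
  intro u hu hker hwt hfold
  rcases h u hu hker hwt hfold with hbit | hq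
  · have hl : 0 < G.l := hS.l_pos
    have hm : 0 < G.m := hS.m_pos
    set u' := transWK G.l G.m nb G.gen.1 G.gen.2 u with hu'
    have hu'lt : u' < 2 ^ nK G nb := transWK_lt hl hm _ _ _ u
    have hker' : kerK col (nK G nb) u' := (hK u hu).1 hker
    have hwt' : popc (nK G nb) u' ≤ W := by rw [hu']; unfold nK; rw [popc_transWK hl hm]; exact hwt
    have hfold' : foldWK G nb u' = t := by
      rw [hu', foldWK_transWK hS hG, hfold, transWK_gen_small hS nb ht]
    rcases h u' hu'lt hker' hwt' hfold' with hbit' | hq'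
    · exfalso
      have hab : (aPartK G nb u ^^^ bPartK G nb u).testBit p₀ = true := by rw [← foldWK_eq_parts, hfold]; exact htp
      rw [Nat.testBit_xor, ← testBit_emb_eqK hG hu hp₀, ← testBit_partner_emb_eqK hG hu hp₀, hbit,
        Bool.false_xor] at hab
      have : u'.testBit (G.emb p₀) = true := by
        rw [hu', ← hG.partner_partner _ (hG.emb_lt p₀ hp₀), partner_eq_transIdxK hS (G.partner (G.emb p₀))]
        rw [testBit_transWK hl hm _ _ _ _ (hG.partner_lt _ (hG.emb_lt p₀ hp₀))]
        exact hab
      rw [hbit'] at this; exact Bool.false_ne_true this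
    · exact hQ u hq'
  · exact hq

/-! ## Node soundness -/

/-- What the guarded continuation establishes per output. -/
theorem guardP_cons_soundK {p₀ : ℕ} {P' : List ℕ} {k : List ℕ → Bool} {Q : ℕ → Prop}
    (hk : ∀ S', (∀ J ∈ S', J < nK G nb) → S'.length = popc (nK G nb) (maskOf S') → k S' = true → Q (maskOf S')) :
    ∀ S', (∀ J ∈ S', J < nK G nb) → S'.length = popc (nK G nb) (maskOf S') → guardP G (p₀ :: P') k S' = true →
      ((maskOf S').testBit (G.emb p₀) = false ∨ Q (maskOf S')) := by
  intro S' hS' hlen h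
  rw [guardP, Bool.or_eq_true, Bool.not_eq_true'] at h
  rcases h with h | h
  · exact Or.inl h
  · exact Or.inr (hk S' hS' hlen h)

/-- The enumeration establishes the per-output conclusion on the whole fibre. -/
theorem goodFibK_of_all (hG : OKK G nb) {col : ℕ → ℕ} {M Mp : ℕ → ℕ}
    (hM : ∀ j, j < nsK G nb → M j = col (G.emb j) ^^^ col (G.partner (G.emb j)))
    (hMp : ∀ j, j < nsK G nb → Mp j = col (G.partner (G.emb j))) {W : ℕ} {t : ℕ} (ht : t < 2 ^ nsK G nb)
    {out : List (List ℕ)} (hout : fiberK G (nsK G nb) M Mp W (bitsOf (nsK G nb) 0 t) = some out)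
    {kk : List ℕ → Bool} {K : ℕ → Prop}
    (hkk : ∀ S', (∀ J ∈ S', J < nK G nb) → S'.length = popc (nK G nb) (maskOf S') → kk S' = true → K (maskOf S'))
    (hall : out.all kk = true) : GoodFibK G nb col W K t := by
  intro u hu hker hwt hfold
  obtain ⟨S', hS', hmask, hbnd, hlen⟩ := fiberK_complete hG hM hMp ht hout hu hker hwt hfold
  rw [List.all_eq_true] at hall
  have := hkk S' hbnd (by rw [hmask]; exact hlen) (hall S' hS')
  rwa [hmask] at this

/-- **NODE SOUNDNESS** (`ETowerDefs.nodeK`): a passing node of the small word with support `S` gives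
`GoodFibK … Q (maskOf S)` — enumeration by `fiberK_complete`, pair guard by `goodFibK_of_guarded`. -/
theorem nodeK_sound (hS : G.Shape) (hG : OKK G nb) {col : ℕ → ℕ}
    (hK : ∀ u, u < 2 ^ nK G nb → (kerK col (nK G nb) u ↔ kerK col (nK G nb) (transWK G.l G.m nb G.gen.1 G.gen.2 u)))
    {M Mp : ℕ → ℕ} (hM : ∀ j, j < nsK G nb → M j = col (G.emb j) ^^^ col (G.partner (G.emb j)))
    (hMp : ∀ j, j < nsK G nb → Mp j = col (G.partner (G.emb j)))
    {W : ℕ} {k : List ℕ → Bool} {Q : ℕ → Prop} (hQ : ∀ u, Q (transWK G.l G.m nb G.gen.1 G.gen.2 u) → Q u)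
    (hk : ∀ S', (∀ J ∈ S', J < nK G nb) → S'.length = popc (nK G nb) (maskOf S') → k S' = true → Q (maskOf S'))
    {S : List ℕ} (hSb : ∀ j ∈ S, j < nsK G nb) (h : nodeK G (nsK G nb) M Mp W k S = true) :
    GoodFibK G nb col W Q (maskOf S) := by
  have hSlt : maskOf S < 2 ^ nsK G nb := maskOf_lt _ _ hSb
  unfold nodeK at h
  simp only at h
  split at h
  · simp at h
  · rename_i out hout
    have hout' : fiberK G (nsK G nb) M Mp W (bitsOf (nsK G nb) 0 (maskOf S)) = some out := hout
    cases hP : bitsOf (nsK G nb) 0 (maskOf S) with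
    | nil =>
      rw [hP] at h
      exact goodFibK_of_all hG hM hMp hSlt hout' (kk := guardP G [] k) (K := Q)
        (fun S' hS' hl h' => hk S' hS' hl (by simpa [guardP] using h')) h
    | cons p₀ P' =>
      rw [hP] at h
      have hKK := goodFibK_of_all hG hM hMp hSlt hout' (kk := guardP G (p₀ :: P') k)
        (K := fun u => u.testBit (G.emb p₀) = false ∨ Q u) (guardP_cons_soundK (p₀ := p₀) (P' := P') hk) h
      have hp₀ : p₀ ∈ bitsOf (nsK G nb) 0 (maskOf S) := by rw [hP]; exact List.mem_cons_self ..
      rw [mem_bitsOf_zero_iff] at hp₀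
      exact goodFibK_of_guarded hG hS hK hSlt hp₀.1 hp₀.2 hQ hKK

/-- **WINDOWED NODE SOUNDNESS** (`ETowerDefs.nodeKW`, no guard): if every window of a family with a `lo = 0` window covering
all outside positions passes, `GoodFibK … Q (maskOf S)`. -/
theorem nodeKW_sound (hG : OKK G nb) {col : ℕ → ℕ} {M Mp : ℕ → ℕ}
    (hM : ∀ j, j < nsK G nb → M j = col (G.emb j) ^^^ col (G.partner (G.emb j)))
    (hMp : ∀ j, j < nsK G nb → Mp j = col (G.partner (G.emb j)))
    {W : ℕ} {k : List ℕ → Bool} {Q : ℕ → Prop}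
    (hk : ∀ S', (∀ J ∈ S', J < nK G nb) → S'.length = popc (nK G nb) (maskOf S') → k S' = true → Q (maskOf S'))
    {S : List ℕ} (hSb : ∀ j ∈ S, j < nsK G nb) (WINS : List (ℕ × ℕ)) (hzero : ∃ w ∈ WINS, w.1 = 0)
    (hcover : ∀ p, p < (outsideOf (nsK G nb) (bitsOf (nsK G nb) 0 (maskOf S))).length → ∃ w ∈ WINS, w.1 ≤ p ∧ p < w.2)
    (h : ∀ w ∈ WINS, nodeKW G (nsK G nb) M Mp W k S w.1 w.2 = true) :
    GoodFibK G nb col W Q (maskOf S) := by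
  have hSlt : maskOf S < 2 ^ nsK G nb := maskOf_lt _ _ hSb
  intro u hu hker hwt hfold
  have hall : ∀ w ∈ WINS, ∃ out, fiberKW G (nsK G nb) M Mp W (bitsOf (nsK G nb) 0 (maskOf S)) w.1 w.2 = some out ∧
      ∀ S' ∈ out, k S' = true := by
    intro w hw
    have hw' := h w hw
    unfold nodeKW at hw'
    simp only at hw'
    split at hw'
    · simp at hw'
    · rename_i out hout
      exact ⟨out, hout, fun S' hS' => List.all_eq_true.1 hw' S' hS'⟩
  obtain ⟨S', hkS', hmask, hbnd, hlen⟩ :=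
    fiberKW_complete hG hM hMp hSlt WINS (fun S' => k S' = true) hzero hcover hall hu hker hwt hfold
  have := hk S' hbnd (by rw [hmask]; exact hlen) hkS'
  rwa [hmask] at this

end Level

end Summit.Ventures.QEC.CircuitDistance.ETower
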